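import Literature.NumberTheory.GelbartRogawski1991.CompatibleSplitting
import HarnessLib

/-!
# [GelbartRogawski1991, Prop. 3.1.1] as a record is MONOTONE: transport of compatible splittings
# along a morphism of splitting data and to coarser topologies on `Mp` (finer on `G(𝐀)`)

Topic `NumberTheory/GelbartRogawski1991`; namespace `Literature.NumberTheory.GelbartRogawski1991`.
Kernel companion of `CompatibleSplitting.lean` written for the citation-fit ledger of the Hodge-CM
acceptance package (row CF06, implication cell (iii)): the two NON-VERBATIM steps of the argument
"Proposition 3.1.1 as printed ⇒ `(cmSplittingDatum …).CompatibleSplitting`" are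
(a) print's metaplectic group `Mp_𝐀(W)` (pairs `(g, M_g)`, `M_g` an operator on the space of `ρ_ψ`,
p. 454 L21–33) maps homomorphically, over `Sp_𝐀(W)` and compatibly with the rational splitting `i`,
to the record's implementer group (LF-continuous automorphisms of the Schwartz–Bruhat model —
[Weil1964, Chap. I n° 11–13, Chap. III n° 39]); (b) the record's topology on `Mp` is COARSER than
print's (restricted-product ∕ Weil) topology, and its topology on `G(𝐀)` is the printed adelic one.
Both steps are instances of the two theorems below, which hold for ABSTRACT splitting data and make
the direction "print ⇒ record" a kernel fact modulo the existence of the morphism in (a):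

* `SplittingDatum.IsCompatible.map` / `SplittingDatum.CompatibleSplitting.map` — if `φ : Mp →* Mp′`
  lies over `Sp` (`π′ ∘ φ = π`), carries `i` into the range of `i′`, the two data have the same `ι`,
  and `G′(F) ≤ G(F)`, then a compatible (continuous) splitting for `D` yields one for `D′`
  (`φ` continuous);
* `SplittingDatum.CompatibleSplitting.mono` — `CompatibleSplitting` for topologies `(t_G, t_M)`
  implies it for any finer `t_G′ ≤ t_G` on `G(𝐀)` and any coarser `t_M ≤ t_M′` on `Mp`
  (Mathlib order: `t ≤ t′` iff `t` is finer).

Kernel only: 0 records, 0 `sorry`; nothing of [GelbartRogawski1991] is asserted here. [folklore]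
-/

namespace Literature.NumberTheory.GelbartRogawski1991

namespace SplittingDatum

universe u v v' w

variable {Sp : Type u} {Mp : Type v} {Mp' : Type v'} {GA : Type w}
variable [Group Sp] [Group Mp] [Group Mp'] [Group GA]
variable {D : SplittingDatum Sp Mp GA} {D' : SplittingDatum Sp Mp' GA}

/-- **Transport of a compatible splitting along a morphism of splitting data.**  Let `φ : Mp →* Mp′`
lie over `Sp` (`π′ (φ m) = π m`), let the two data have the same `ι` (`toSp`), let `G′(F) ≤ G(F)`,
and let `φ` carry the rational splitting `i` of `D` into the range of the rational splitting `i′` of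
`D′`.  Then `φ ∘ s` is compatible for `D′` whenever `s` is compatible for `D` — the formal content of
"(`ρ_ψ` is unique up to isomorphism)" (p. 454 L26–27): Proposition 3.1.1 does not depend on the model
of `ρ_ψ` on which the pairs `(g, M_g)` are realised.
[cite: GelbartRogawski1991, §3.1 p. 454 L21–33 with Prop. 3.1.1 p. 455 L1–3] -/
theorem IsCompatible.map (φ : Mp →* Mp') (hproj : ∀ m : Mp, D'.proj (φ m) = D.proj m)
    (htoSp : ∀ g : GA, D'.toSp g = D.toSp g) (hrat : D'.ratPts ≤ D.ratPts)
    (hsplit : ∀ x : D.spRat, φ (D.ratSplit x) ∈ D'.ratSplit.range) {s : GA →* Mp}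
    (hs : D.IsCompatible s) : D'.IsCompatible (φ.comp s) := by
  refine ⟨fun g => ?_, fun γ hγ => ?_⟩
  · rw [MonoidHom.comp_apply, hproj, hs.1 g, htoSp]
  · obtain ⟨x, hx⟩ := hs.2 γ (hrat hγ)
    rw [MonoidHom.comp_apply, ← hx]
    exact hsplit x

/-- **[GelbartRogawski1991, Prop. 3.1.1]'s conclusion transports along a continuous morphism of
splitting data**: under the hypotheses of `IsCompatible.map` with `φ` continuous,
`D.CompatibleSplitting → D′.CompatibleSplitting`.  (Object-match (a) of `CompatibleSplitting.lean`:
print's `Mp_𝐀(W)` → the implementer group of the Schwartz–Bruhat model, [Weil1964, Chap. I n° 11–13].)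
[cite: GelbartRogawski1991, §3.1 p. 454 L21–33 with Prop. 3.1.1 p. 455 L1–3] -/
theorem CompatibleSplitting.map [TopologicalSpace GA] [TopologicalSpace Mp] [TopologicalSpace Mp']
    (φ : Mp →* Mp') (hφ : Continuous φ) (hproj : ∀ m : Mp, D'.proj (φ m) = D.proj m)
    (htoSp : ∀ g : GA, D'.toSp g = D.toSp g) (hrat : D'.ratPts ≤ D.ratPts)
    (hsplit : ∀ x : D.spRat, φ (D.ratSplit x) ∈ D'.ratSplit.range)
    (h : D.CompatibleSplitting) : D'.CompatibleSplitting := by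
  obtain ⟨s, hsc, hs⟩ := h
  exact ⟨φ.comp s, hφ.comp hsc, hs.map φ hproj htoSp hrat hsplit⟩

/-- **Monotonicity in the topologies**: a compatible splitting continuous for `(t_G, t_M)` is
continuous for any finer topology `t_G′ ≤ t_G` on `G(𝐀)` and any coarser topology `t_M ≤ t_M′` on
`Mp`.  (Object-match (e) of `CompatibleSplitting.lean`: the record's initial topology on `Mp_ψ(W_𝔸)` is
coarser than the printed restricted-product topology, for which `Mp(X)_A` acts continuously on
`𝒮(X_A)` — so "continuous" in print implies `Continuous` in the record.)
[cite: Weil1964, Chap. III n° 39 p. 189; GelbartRogawski1991, §3.1 Prop. 3.1.1 p. 455 L1–3] -/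
theorem CompatibleSplitting.mono {tG tG' : TopologicalSpace GA} {tM tM' : TopologicalSpace Mp}
    (hG : tG' ≤ tG) (hM : tM ≤ tM')
    (h : @CompatibleSplitting Sp Mp GA _ _ _ D tG tM) :
    @CompatibleSplitting Sp Mp GA _ _ _ D tG' tM' := by
  obtain ⟨s, hsc, hs⟩ := h
  exact ⟨s, continuous_le_rng hM (continuous_le_dom hG hsc), hs⟩

end SplittingDatum

end Literature.NumberTheory.GelbartRogawski1991
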